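import Literature.Barriers.AtomisticToContinuum.NoUniversallyOptimalLattice3D
import Literature.Algebra.EuclideanLattices.CubicLatticeTheta
import Mathlib.Analysis.Complex.Exponential
import HarnessLib

/-!
# Proof of `CohnKumar2007_fcc_gaussianEnergy_gt_bcc` (fcc loses to bcc for `e^{-|x|²}`)

This file discharges the named fact
`Literature.Barriers.AtomisticToContinuum.CohnKumar2007_fcc_gaussianEnergy_gt_bcc` of
`NoUniversallyOptimalLattice3D.lean` (Cohn–Kumar, JAMS 2007, §9, after Conjecture 9.4 — arXiv
numbering "Conjecture 32", p. 25: "Each of these lattices has higher energy than its dual lattice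
for the potential function `f(x) = e^{−x}`, when both lattices are rescaled to have unit
density"; here `d = 3`, `A₃ =` fcc, `A₃* =` bcc):
`gaussianEnergy 1 bccUnitDensity < gaussianEnergy 1 fccUnitDensity`, numerically
`4.56859376 < 4.56868459` — a gap of `9.1·10⁻⁵`, so the proof is a certified computation.

## Architecture

1. `gaussianEnergy_one_eq_tsum_indicator`: for `S = t·D`, `D ⊆ ℤ³`, the energy
   `∑_{x ∈ S∖0} e^{-‖x‖²}` is the indicator sum `∑_{v ∈ D∖0} ∏ᵢ q^{vᵢ²}` over `ℤ³` with
   `q = e^{-t²}` (`tsum_image` along the injective scaling, `‖t v‖² = t² ∑ vᵢ²`).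
2. Conway–Sloane's identities (SPLAG Ch. 4 (66), (84)), proved in
   `Literature/Algebra/EuclideanLattices/CubicLatticeTheta.lean`:
   `E_fcc + 1 = θ₀³ + 3θ₀θ₁²` at `q_fcc = e^{-2^{-2/3}}` and `E_bcc + 1 = θ₀³ + θ₁³` at
   `q_bcc = e^{-4^{-2/3}}`, where `θ₀(q) = θ₃(q⁴) = ∑_{n∈ℤ} q^{4n²}`,
   `θ₁(q) = θ₂(q⁴) = ∑_{n∈ℤ} q^{(2n+1)²}`.
3. Moduli: `(2^{-1/3})⁶ = 1/4`, `(4^{-1/3})⁶ = 1/16` pin `t²` between rationals by comparing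
   cubes; `Real.exp_bound'` / `Real.sum_le_exp_of_nonneg` (12 Taylor terms) then give
   `q_fcc ≥ 0.5326128` and `q_bcc ≤ 0.6724348` (true values `0.53261282…`, `0.67243470…`).
4. Envelopes (`theta_zero_ge/le`, `theta_one_ge/le`: truncation plus a geometric tail, monotone
   in `q`) and exact rational arithmetic (`norm_num`):
   `E_bcc + 1 ≤ 1.412409³ + 1.4011867³ = 5.56859727… < 5.56868296… = 1.1610284³ +
   3·1.1610284·1.072124² ≤ E_fcc + 1`.

Only a lower bound for fcc and an upper bound for bcc are needed, hence only one-sided bounds on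
each modulus. No new definitions; axioms `propext`, `Classical.choice`, `Quot.sound`.

## References

* H. Cohn, A. Kumar, *Universally optimal distribution of points on spheres*, J. Amer. Math.
  Soc. 20 (2007) 99–148, §9 (arXiv:math/0607446, p. 25) [CohnKumar2006].
* J. H. Conway, N. J. A. Sloane, *Sphere Packings, Lattices and Groups*, 3rd ed. (1999), Ch. 4
  §6.3 eq. (66), §6.7 eq. (84) [ConwaySloane1999].
-/

noncomputable section

namespace Literature.Barriers.AtomisticToContinuum

open Literature.Algebra.EuclideanLattices

/-! ## From the Euclidean point sets to indicator sums over `ℤ³` -/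

/-- Coordinates of a scaled integer point: `(t·v)ᵢ = t vᵢ`. [folklore] -/
theorem scaledIntPoint_apply (t : ℝ) (v : Fin 3 → ℤ) (i : Fin 3) :
    scaledIntPoint t v i = t * (v i : ℝ) := by
  simp [scaledIntPoint]

/-- `‖t·v‖² = ∑ᵢ t² vᵢ²`. [folklore] -/
theorem norm_scaledIntPoint_sq (t : ℝ) (v : Fin 3 → ℤ) :
    ‖scaledIntPoint t v‖ ^ 2 = ∑ i : Fin 3, t ^ 2 * ((v i : ℝ)) ^ 2 := by
  rw [EuclideanSpace.real_norm_sq_eq]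
  simp [scaledIntPoint_apply, mul_pow]

/-- The Gaussian weight of a scaled integer point factorises over coordinates:
`e^{-‖t v‖²} = ∏ᵢ q^{vᵢ²}` with `q = e^{-t²}`. [folklore] -/
theorem exp_neg_norm_sq_scaledIntPoint (t : ℝ) (v : Fin 3 → ℤ) :
    Real.exp (-1 * ‖scaledIntPoint t v‖ ^ 2) =
      ∏ i : Fin 3, Real.exp (-(t ^ 2)) ^ ((v i).natAbs ^ 2) := by
  rw [norm_scaledIntPoint_sq, neg_one_mul, ← Finset.sum_neg_distrib, Real.exp_sum]
  refine Finset.prod_congr rfl fun i _ => ?_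
  rw [← Real.exp_nat_mul]
  congr 1
  push_cast
  rw [Nat.cast_natAbs, Int.cast_abs, sq_abs]
  ring

/-- `v ↦ t·v` is injective for `t ≠ 0`. [folklore] -/
theorem scaledIntPoint_injective {t : ℝ} (ht : t ≠ 0) :
    Function.Injective (scaledIntPoint t) := by
  intro v w hvw
  funext i
  have := congrArg (fun x => x i) hvw
  simp [scaledIntPoint_apply, ht] at this
  exact_mod_cast this

/-- `t·0 = 0`. [folklore] -/
theorem scaledIntPoint_zero (t : ℝ) : scaledIntPoint t 0 = 0 := by
  ext i; simp [scaledIntPoint]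

/-- **Energy as a lattice sum over `ℤ³`.** For `S = t·D` (`t ≠ 0`, `D ⊆ ℤ³`),
`E_{e^{-x}}(S) = ∑_{v ∈ D ∖ 0} ∏ᵢ q^{vᵢ²}` with `q = e^{-t²}`. [folklore] -/
theorem gaussianEnergy_one_eq_tsum_indicator {t : ℝ} (ht : t ≠ 0) (D : Set (Fin 3 → ℤ))
    {S : Set (EuclideanSpace ℝ (Fin 3))} (hS : S = scaledIntPoint t '' D) :
    gaussianEnergy 1 S = ∑' v : Fin 3 → ℤ,
      (D \ {0}).indicator (fun v => ∏ i : Fin 3, Real.exp (-(t ^ 2)) ^ ((v i).natAbs ^ 2)) v := by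
  have hset : {x | x ∈ S ∧ x ≠ 0} = scaledIntPoint t '' (D \ {0}) := by
    ext x
    simp only [Set.mem_setOf_eq, Set.mem_image, Set.mem_sdiff, Set.mem_singleton_iff, hS]
    constructor
    · rintro ⟨⟨v, hv, rfl⟩, hx⟩
      exact ⟨v, ⟨hv, fun hv0 => hx (by rw [hv0, scaledIntPoint_zero])⟩, rfl⟩
    · rintro ⟨v, ⟨hv, hv0⟩, rfl⟩
      exact ⟨⟨v, hv, rfl⟩, fun hx =>
        hv0 (scaledIntPoint_injective ht (by rw [hx, scaledIntPoint_zero]))⟩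
  have hfun : (fun v : Fin 3 → ℤ => Real.exp (-1 * ‖scaledIntPoint t v‖ ^ 2)) =
      fun v => ∏ i : Fin 3, Real.exp (-(t ^ 2)) ^ ((v i).natAbs ^ 2) :=
    funext (exp_neg_norm_sq_scaledIntPoint t)
  unfold gaussianEnergy
  rw [show (∑' x : {x : EuclideanSpace ℝ (Fin 3) // x ∈ S ∧ x ≠ 0}, Real.exp (-1 * ‖x.1‖ ^ 2))
      = ∑' x : ↥{x : EuclideanSpace ℝ (Fin 3) | x ∈ S ∧ x ≠ 0}, Real.exp (-1 * ‖x.1‖ ^ 2)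
      from rfl,
    tsum_congr_set_coe (fun x => Real.exp (-1 * ‖x‖ ^ 2)) hset,
    tsum_image (fun x => Real.exp (-1 * ‖x‖ ^ 2)) (scaledIntPoint_injective ht).injOn, ← hfun]
  exact tsum_subtype (D \ {0}) (fun v => Real.exp (-1 * ‖scaledIntPoint t v‖ ^ 2))

/-- fcc at unit density is `2^{-1/3} · D₃`. [cite: ConwaySloane1999, Ch. 4 §6.3] -/
theorem fccUnitDensity_eq_image : fccUnitDensity =
    scaledIntPoint ((2 : ℝ) ^ (-(1 : ℝ) / 3)) '' {v : Fin 3 → ℤ | Even (v 0 + v 1 + v 2)} := by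
  ext x
  simp only [fccUnitDensity, Set.mem_setOf_eq, Set.mem_image]
  constructor <;> rintro ⟨v, hv, hx⟩ <;> exact ⟨v, hv, hx.symm⟩

/-- bcc at unit density is `4^{-1/3} · {v : v₁ ≡ v₂ ≡ v₃ (2)}`.
[cite: ConwaySloane1999, Ch. 4 §6.7] -/
theorem bccUnitDensity_eq_image : bccUnitDensity =
    scaledIntPoint ((4 : ℝ) ^ (-(1 : ℝ) / 3)) ''
      {v : Fin 3 → ℤ | v 0 ≡ v 1 [ZMOD 2] ∧ v 1 ≡ v 2 [ZMOD 2]} := by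
  ext x
  simp only [bccUnitDensity, Set.mem_setOf_eq, Set.mem_image]
  constructor <;> rintro ⟨v, hv, hx⟩ <;> exact ⟨v, hv, hx.symm⟩

/-! ## The two moduli `q_fcc = e^{-2^{-2/3}} ≥ 0.5326128`, `q_bcc = e^{-4^{-2/3}} ≤ 0.6724348` -/

/-- `(2^{-1/3})⁶ = 1/4`. [folklore] -/
theorem rpow_fcc_pow_six : ((2 : ℝ) ^ (-(1 : ℝ) / 3)) ^ 6 = 1 / 4 := by
  rw [← Real.rpow_natCast, ← Real.rpow_mul (by norm_num)]
  norm_num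

/-- `(4^{-1/3})⁶ = 1/16`. [folklore] -/
theorem rpow_bcc_pow_six : ((4 : ℝ) ^ (-(1 : ℝ) / 3)) ^ 6 = 1 / 16 := by
  rw [← Real.rpow_natCast, ← Real.rpow_mul (by norm_num)]
  norm_num

/-- `e^{-2^{-2/3}} ≥ 0.5326128` (from `2^{-2/3} ≤ 0.62996053`, cube `≥ 1/4`, and the degree-`12`
Taylor bound `Real.exp_bound'` at that rational). [folklore] -/
theorem la_le_exp_fcc :
    (5326128 / 10 ^ 7 : ℝ) ≤ Real.exp (-(((2 : ℝ) ^ (-(1 : ℝ) / 3)) ^ 2)) := by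
  set t := (2 : ℝ) ^ (-(1 : ℝ) / 3) with ht
  have ht6 : (t ^ 2) ^ 3 = 1 / 4 := by rw [← pow_mul]; exact rpow_fcc_pow_six
  have hle : t ^ 2 ≤ 62996053 / 10 ^ 8 :=
    le_of_pow_le_pow_left₀ (by norm_num) (by norm_num) (ht6.trans_le (by norm_num))
  have hexp := Real.exp_bound' (x := (62996053 / 10 ^ 8 : ℝ)) (by norm_num) (by norm_num)
    (n := 12) (by norm_num)
  simp only [Finset.sum_range_succ, Finset.sum_range_zero, Nat.factorial] at hexp
  rw [Real.exp_neg, le_inv_comm₀ (by norm_num) (Real.exp_pos _)]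
  refine ((Real.exp_le_exp.2 hle).trans hexp).trans ?_
  norm_num

/-- `e^{-4^{-2/3}} ≤ 0.6724348` (from `0.39685026 ≤ 4^{-2/3}`, cube `≤ 1/16`, and the Taylor
lower bound `Real.sum_le_exp_of_nonneg` with `12` terms). [folklore] -/
theorem exp_bcc_le_hb :
    Real.exp (-(((4 : ℝ) ^ (-(1 : ℝ) / 3)) ^ 2)) ≤ 6724348 / 10 ^ 7 := by
  set t := (4 : ℝ) ^ (-(1 : ℝ) / 3) with ht
  have ht6 : (t ^ 2) ^ 3 = 1 / 16 := by rw [← pow_mul]; exact rpow_bcc_pow_six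
  have hle : (39685026 / 10 ^ 8 : ℝ) ≤ t ^ 2 :=
    le_of_pow_le_pow_left₀ (by norm_num) (by positivity) (le_of_le_of_eq (by norm_num) ht6.symm)
  have hexp := Real.sum_le_exp_of_nonneg (x := (39685026 / 10 ^ 8 : ℝ)) (by norm_num) 12
  simp only [Finset.sum_range_succ, Finset.sum_range_zero, Nat.factorial] at hexp
  rw [Real.exp_neg, inv_le_comm₀ (Real.exp_pos _) (by norm_num)]
  refine le_trans ?_ (hexp.trans (Real.exp_le_exp.2 hle))
  norm_num

/-! ## Assembly -/

/-- The decisive rational inequality `1.412409³ + 1.4011867³ < 1.1610284³ + 3·1.1610284·1.072124²`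
(`5.5685973 < 5.5686830`, margin `8.6·10⁻⁵`). [folklore] -/
theorem fcc_bcc_numeric_core :
    (1412409 / 10 ^ 6 : ℝ) ^ 3 + (14011867 / 10 ^ 7) ^ 3 <
      (11610284 / 10 ^ 7 : ℝ) ^ 3 + 3 * ((11610284 / 10 ^ 7) * (1072124 / 10 ^ 6) ^ 2) := by
  norm_num

/-- `θ₀(0.6724348)`-envelope `≤ 1.412409`. [folklore] -/
theorem hb_theta_zero : 1 + 2 * ((6724348 / 10 ^ 7 : ℝ) ^ 4 + (6724348 / 10 ^ 7) ^ 16 +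
    (6724348 / 10 ^ 7) ^ 36 / (1 - (6724348 / 10 ^ 7) ^ 24)) ≤ 1412409 / 10 ^ 6 := by
  norm_num

/-- `θ₁(0.6724348)`-envelope `≤ 1.4011867`. [folklore] -/
theorem hb_theta_one : 2 * ((6724348 / 10 ^ 7 : ℝ) + (6724348 / 10 ^ 7) ^ 9 +
    (6724348 / 10 ^ 7) ^ 25 + (6724348 / 10 ^ 7) ^ 49 / (1 - (6724348 / 10 ^ 7) ^ 28)) ≤
    14011867 / 10 ^ 7 := by
  norm_num

/-- `θ₀(0.5326128)`-envelope `≥ 1.1610284`. [folklore] -/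
theorem la_theta_zero :
    (11610284 / 10 ^ 7 : ℝ) ≤ 1 + 2 * ((5326128 / 10 ^ 7 : ℝ) ^ 4 + (5326128 / 10 ^ 7) ^ 16) := by
  norm_num

/-- `θ₁(0.5326128)`-envelope `≥ 1.072124`. [folklore] -/
theorem la_theta_one : (1072124 / 10 ^ 6 : ℝ) ≤
    2 * ((5326128 / 10 ^ 7 : ℝ) + (5326128 / 10 ^ 7) ^ 9 + (5326128 / 10 ^ 7) ^ 25) := by
  norm_num

/-- **Cohn–Kumar 2007, §9 (the `d = 3` case), discharged**: at unit density the face-centred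
cubic lattice `A₃` has larger `e^{-|x|²}`-energy than its dual, the body-centred cubic lattice:
`∑_{x ∈ bcc₁ ∖ 0} e^{-|x|²} < ∑_{x ∈ fcc₁ ∖ 0} e^{-|x|²}` (`4.5685938 < 4.5686846`).
Proof: Conway–Sloane's theta identities (66), (84) reduce both energies to
`θ₀ = θ₃(q⁴)`, `θ₁ = θ₂(q⁴)` at `q_fcc = e^{-2^{-2/3}} ≥ 0.5326128` and
`q_bcc = e^{-4^{-2/3}} ≤ 0.6724348`; truncation/geometric-tail envelopes of `θ₀, θ₁` and exact
rational arithmetic give `E_bcc + 1 ≤ 5.5685973 < 5.5686830 ≤ E_fcc + 1`.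
[cite: CohnKumar2006, §9 (paragraph after Conjecture 9.4; arXiv p. 25)] -/
theorem CohnKumar2007_fcc_gaussianEnergy_gt_bcc_holds :
    CohnKumar2007_fcc_gaussianEnergy_gt_bcc := by
  have htf0 : (0 : ℝ) < (2 : ℝ) ^ (-(1 : ℝ) / 3) := Real.rpow_pos_of_pos (by norm_num) _
  have htb0 : (0 : ℝ) < (4 : ℝ) ^ (-(1 : ℝ) / 3) := Real.rpow_pos_of_pos (by norm_num) _
  have hqa0 : 0 ≤ Real.exp (-(((2 : ℝ) ^ (-(1 : ℝ) / 3)) ^ 2)) := (Real.exp_pos _).le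
  have hqb0 : 0 ≤ Real.exp (-(((4 : ℝ) ^ (-(1 : ℝ) / 3)) ^ 2)) := (Real.exp_pos _).le
  have hqa1 : Real.exp (-(((2 : ℝ) ^ (-(1 : ℝ) / 3)) ^ 2)) < 1 :=
    Real.exp_lt_one_iff.2 (neg_neg_of_pos (pow_pos htf0 2))
  have hqb1 : Real.exp (-(((4 : ℝ) ^ (-(1 : ℝ) / 3)) ^ 2)) < 1 :=
    Real.exp_lt_one_iff.2 (neg_neg_of_pos (pow_pos htb0 2))
  unfold CohnKumar2007_fcc_gaussianEnergy_gt_bcc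
  rw [gaussianEnergy_one_eq_tsum_indicator htb0.ne' _ bccUnitDensity_eq_image,
    tsum_indicator_bccInt hqb0 hqb1,
    gaussianEnergy_one_eq_tsum_indicator htf0.ne' _ fccUnitDensity_eq_image,
    tsum_indicator_fccInt hqa0 hqa1]
  set qa := Real.exp (-(((2 : ℝ) ^ (-(1 : ℝ) / 3)) ^ 2)) with hqa
  set qb := Real.exp (-(((4 : ℝ) ^ (-(1 : ℝ) / 3)) ^ 2)) with hqb
  have hla : 5326128 / 10 ^ 7 ≤ qa := la_le_exp_fcc
  have hhb : qb ≤ 6724348 / 10 ^ 7 := exp_bcc_le_hb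
  have B0 : ∑' n : ℤ, qb ^ ((2 * n + 0).natAbs ^ 2) ≤ 1412409 / 10 ^ 6 :=
    (theta_zero_le hqb0 hhb (by norm_num)).trans hb_theta_zero
  have B1 : ∑' n : ℤ, qb ^ ((2 * n + 1).natAbs ^ 2) ≤ 14011867 / 10 ^ 7 :=
    (theta_one_le hqb0 hhb (by norm_num)).trans hb_theta_one
  have G0 : 11610284 / 10 ^ 7 ≤ ∑' n : ℤ, qa ^ ((2 * n + 0).natAbs ^ 2) :=
    la_theta_zero.trans (theta_zero_ge (by norm_num) hla hqa1)
  have G1 : 1072124 / 10 ^ 6 ≤ ∑' n : ℤ, qa ^ ((2 * n + 1).natAbs ^ 2) :=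
    la_theta_one.trans (theta_one_ge (by norm_num) hla hqa1)
  have P0 := pow_le_pow_left₀ (theta_nonneg hqb0 0) B0 3
  have P1 := pow_le_pow_left₀ (theta_nonneg hqb0 1) B1 3
  have Q0 := pow_le_pow_left₀ (by norm_num) G0 3
  have Q1 := pow_le_pow_left₀ (by norm_num) G1 2
  have Q2 : (11610284 / 10 ^ 7 : ℝ) * (1072124 / 10 ^ 6) ^ 2 ≤
      (∑' n : ℤ, qa ^ ((2 * n + 0).natAbs ^ 2)) * (∑' n : ℤ, qa ^ ((2 * n + 1).natAbs ^ 2)) ^ 2 :=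
    mul_le_mul G0 Q1 (by norm_num) (by linarith)
  have hcore := fcc_bcc_numeric_core
  linarith

end Literature.Barriers.AtomisticToContinuum

end
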